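import Mathlib
import Summits.QuantumFields.YangMills.Theorems.F4SubCurvatureDoorPlanarFrameHolomorphyAllFrames
import Summits.QuantumFields.YangMills.Theorems.F4SubCurvatureDoorPlanarConicChartFrames
import Summits.QuantumFields.YangMills.Theorems.F4SubCurvatureDoorPlanarFrames
import HarnessLib

/-!
# Rung R1⁺ «PlanarConicChart» of LINE g20-A «angular type», part 2/2: the rung BY NAME
# (planner ym-idea-3 g20, crux ⟨stmt-QuantumFields-23035⟩ `F4SubCurvatureDoor.ShortRootRigidity`; owner file
# `Cruxes/ShortRootRigidity/Lines/angular_type_rungs.lean`)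

Free-hands work of the LEAD seat ym-line-sfw-p2 (gen 74).  THE CONIC CHART: for a kernel `k` of the hexagonal planar class
and every `y ≠ 0`, the kernel is, on the real points of the complex polydisc of radius `c‖y‖` around `y` (`c > 0` universal),
the trace of ONE function holomorphic on that polydisc, bounded there by any bound of `|k|` on `{‖y'‖ ≥ c‖y‖}`.

Proof (the plan of the owner file).  Of the three frame directions `e₀`, `n₊ = (½, √3/2)`, `n₋ = (½, −√3/2)` at least two have
`|⟪y, n_θ⟫| ≥ ‖y‖/2` (the tree's `…F4SubCurvatureDoorPlanarFrames.exists_good_pair`, reused); rung R0 in all three frames (`frameTimeHolomorphy`, `…_sixty`, `…_negSixty`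
of `…PlanarFrameHolomorphyAllFrames`) feeds the two-frame chart `conicChart_of_two_frames` (part 1: slices + Bernstein's local
cross theorem + complex-affine pull-back), used with the least admissible bound `sSup {|k y'| : ‖y'‖ ≥ c‖y‖}` (finite by
`exists_bound_off_ball`) so that one `F` serves every `M`.  THIS IS WHERE THE 60° GEOMETRY IS LOAD-BEARING (for two
perpendicular frames the statement is false on the axes).

The Prop `PlanarConicChart` is restated CHARACTER-FOR-CHARACTER from the owner file (same namespace).
HONEST LABEL: a budget-free rung (R1⁺, size M) toward the XL stub (C) `PlanarSpectralCone`; R1 `PlanarAnalyticOffZero`, (C), (A)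
and the crux are untouched; no crux, rung of LADDER-YM, leaf or summit is proved; the Yang–Mills mass gap is NOT proved by this.
-/

noncomputable section

namespace Summit.QuantumFields.YangMills.Cruxes.ShortRootRigidity.AngularTypeRungs

open scoped Topology InnerProductSpace BigOperators
open Set Metric
open Summit.QuantumFields.YangMills.Theorems.F4SubCurvatureDoorSliceDensityRegistered (E2)
open Summit.QuantumFields.YangMills.Theorems.F4SubCurvatureDoorSliceInClassRegistered (InPlanarClass)

/-- **R1⁺ · PlanarConicChart** (target, M; budget-free; the quantitative form S2 consumes).  There is `c > 0` (depending on
`k` only through nothing — in fact universal, but stated per `k`) such that at every `y ≠ 0` the kernel is, on the real points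
of the complex polydisc of radius `c‖y‖` around `y`, the trace of a function holomorphic on that polydisc and bounded there by
ANY bound of `|k|` on `{y' : c‖y‖ ≤ ‖y'‖}`.  Plan: two frames with `|y · n_θ| ≥ ‖y‖/2` + R0 + Bernstein's local cross theorem
`Literature.Analysis.Complex.exists_holomorphic_extension_of_separately_three_local` + dilation.
[target; sources: JarnickiPflug2011 Ch. 5; Bernstein 1912] -/
def PlanarConicChart : Prop :=
  ∀ k : E2 → ℝ, InPlanarClass k → ∃ c : ℝ, 0 < c ∧ ∀ y : E2, y ≠ 0 →
    ∃ F : ℂ × ℂ → ℂ,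
      DifferentiableOn ℂ F (Metric.ball ((((y 0 : ℝ) : ℂ), ((y 1 : ℝ) : ℂ)) : ℂ × ℂ) (c * ‖y‖)) ∧
      (∀ a b : ℝ, |a - y 0| < c * ‖y‖ → |b - y 1| < c * ‖y‖ → F ((a : ℂ), (b : ℂ)) = k (mk2 a b)) ∧
      ∀ M : ℝ, (∀ y' : E2, c * ‖y‖ ≤ ‖y'‖ → |k y'| ≤ M) →
        ∀ w ∈ Metric.ball ((((y 0 : ℝ) : ℂ), ((y 1 : ℝ) : ℂ)) : ℂ × ℂ) (c * ‖y‖), ‖F w‖ ≤ M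

/-! ## Rung R0 in the frame `e₀`, restated on the direction vector -/

variable {k : E2 → ℝ}

/-- R0 in the frame `e₀` (the time axis), in the direction-vector form used below: for `⟪y, e₀⟫ ≠ 0`, `u ↦ k(y + u e₀)`
is on `(−|⟪y, e₀⟫|, |⟪y, e₀⟫|)` the trace of a function holomorphic on the disc of radius `|⟪y, e₀⟫|`, bounded by the axis
values. -/
theorem frameHolomorphy_zero (hk : InPlanarClass k) :
    ∀ y : E2, ⟪y, (EuclideanSpace.single 0 (1 : ℝ) : E2)⟫_ℝ ≠ 0 →
      ∃ g : ℂ → ℂ, DifferentiableOn ℂ g (ball (0 : ℂ) |⟪y, (EuclideanSpace.single 0 (1 : ℝ) : E2)⟫_ℝ|) ∧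
        (∀ u : ℝ, |u| < |⟪y, (EuclideanSpace.single 0 (1 : ℝ) : E2)⟫_ℝ| →
          g u = k (y + u • (EuclideanSpace.single 0 (1 : ℝ) : E2))) ∧
        ∀ w ∈ ball (0 : ℂ) |⟪y, (EuclideanSpace.single 0 (1 : ℝ) : E2)⟫_ℝ|,
          ‖g w‖ ≤ k ((⟪y, (EuclideanSpace.single 0 (1 : ℝ) : E2)⟫_ℝ + w.re) • (EuclideanSpace.single 0 (1 : ℝ) : E2)) := by
  intro y hy
  have h := frameTimeHolomorphy hk (LinearIsometryEquiv.refl ℝ E2) (fun _ => rfl) y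
  exact h hy

/-! ## The theorem -/

/-- **R1⁺ · PlanarConicChart holds.**  Two good frames (`exists_good_pair`) + `conicChart_of_two_frames` with the least
admissible bound `sSup {|k y'| : ‖y'‖ ≥ c‖y‖}` (finite by `exists_bound_off_ball`), so that one `F` serves every `M`. -/
theorem planarConicChart : PlanarConicChart := by
  intro k hk
  refine ⟨conicConst, conicConst_pos, fun y hy => ?_⟩
  have hy0 : 0 < ‖y‖ := norm_pos_iff.mpr hy
  have h3 : Real.sqrt 3 * Real.sqrt 3 = 3 := Real.mul_self_sqrt (by norm_num)
  -- the least admissible bound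
  obtain ⟨M₀, hM₀⟩ := exists_bound_off_ball hk (mul_pos conicConst_pos hy0)
  set S : Set ℝ := (fun y' : E2 => |k y'|) '' {y' : E2 | conicConst * ‖y‖ ≤ ‖y'‖} with hS
  have hSb : BddAbove S := ⟨M₀, by rintro _ ⟨y', hy', rfl⟩; exact hM₀ y' hy'⟩
  have hyS : |k y| ∈ S :=
    ⟨y, by
      show conicConst * ‖y‖ ≤ ‖y‖
      nlinarith [conicConst_le_eighth], rfl⟩
  have hM : ∀ y' : E2, conicConst * ‖y‖ ≤ ‖y'‖ → |k y'| ≤ sSup S :=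
    fun y' hy' => le_csSup hSb ⟨y', hy', rfl⟩
  have hmin : ∀ M : ℝ, (∀ y' : E2, conicConst * ‖y‖ ≤ ‖y'‖ → |k y'| ≤ M) → sSup S ≤ M :=
    fun M hM' => csSup_le ⟨_, hyS⟩ (by rintro _ ⟨y', hy', rfl⟩; exact hM' y' hy')
  -- inner products of the frame directions
  have i01 : |⟪(EuclideanSpace.single 0 (1 : ℝ) : E2), mk2 (1 / 2) (Real.sqrt 3 / 2)⟫_ℝ| ≤ 1 / 2 := by
    rw [inner_hexNormal]
    simp
  have i02 : |⟪(EuclideanSpace.single 0 (1 : ℝ) : E2), mk2 (1 / 2) (-(Real.sqrt 3 / 2))⟫_ℝ| ≤ 1 / 2 := by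
    rw [inner_hexNormal']
    simp
  have i12 : |⟪mk2 (1 / 2) (Real.sqrt 3 / 2), mk2 (1 / 2) (-(Real.sqrt 3 / 2))⟫_ℝ| ≤ 1 / 2 := by
    rw [inner_hexNormal', mk2_apply_zero, mk2_apply_one, abs_le]
    constructor <;> nlinarith [h3]
  have main : ∃ F : ℂ × ℂ → ℂ,
      DifferentiableOn ℂ F (ball ((((y 0 : ℝ) : ℂ), ((y 1 : ℝ) : ℂ)) : ℂ × ℂ) (conicConst * ‖y‖)) ∧
      (∀ a b : ℝ, |a - y 0| < conicConst * ‖y‖ → |b - y 1| < conicConst * ‖y‖ →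
        F ((a : ℂ), (b : ℂ)) = k (mk2 a b)) ∧
      ∀ w ∈ ball ((((y 0 : ℝ) : ℂ), ((y 1 : ℝ) : ℂ)) : ℂ × ℂ) (conicConst * ‖y‖), ‖F w‖ ≤ sSup S := by
    rcases Summit.QuantumFields.YangMills.Theorems.F4SubCurvatureDoorPlanarFrames.exists_good_pair y with
      ⟨h0, h1⟩ | ⟨h0, h1⟩ | ⟨h0, h1⟩
    · refine conicChart_of_two_frames norm_single_zero norm_hexNormal i01 (frameHolomorphy_zero hk)
        (frameTimeHolomorphy_sixty hk) 1 (-(Real.sqrt 3 / 3)) 0 (2 * Real.sqrt 3 / 3) dual_zero_sixty ?_ ?_ hy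
        (by rwa [inner_single_zero]) (by rwa [inner_hexNormal]) hM
      · simpa using abs_coeff_le_two (-1) (Or.inr rfl)
      · simpa using abs_coeff_le_two' 1 (Or.inl rfl)
    · refine conicChart_of_two_frames norm_single_zero norm_hexNormal' i02 (frameHolomorphy_zero hk)
        (frameTimeHolomorphy_negSixty hk) 1 (Real.sqrt 3 / 3) 0 (-(2 * Real.sqrt 3 / 3)) dual_zero_negSixty ?_ ?_ hy
        (by rwa [inner_single_zero]) (by rwa [inner_hexNormal']) hM
      · simpa using abs_coeff_le_two 1 (Or.inl rfl)
      · simpa using abs_coeff_le_two' (-1) (Or.inr rfl)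
    · refine conicChart_of_two_frames norm_hexNormal norm_hexNormal' i12 (frameTimeHolomorphy_sixty hk)
        (frameTimeHolomorphy_negSixty hk) 1 (Real.sqrt 3 / 3) 1 (-(Real.sqrt 3 / 3)) dual_sixty_negSixty ?_ ?_ hy
        (by rwa [inner_hexNormal]) (by rwa [inner_hexNormal']) hM
      · simpa using abs_coeff_le_two 1 (Or.inl rfl)
      · simpa using abs_coeff_le_two (-1) (Or.inr rfl)
  obtain ⟨F, hFd, hFr, hFb⟩ := main
  exact ⟨F, hFd, hFr, fun M hM' w hw => (hFb w hw).trans (hmin M hM')⟩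

end Summit.QuantumFields.YangMills.Cruxes.ShortRootRigidity.AngularTypeRungs

end
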